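import Literature.NumberTheory.Automorphic.SatakeTransformDuality
import Literature.NumberTheory.Automorphic.SymplecticSatakeTransform
import Literature.NumberTheory.Automorphic.SymplecticGroupHyperspecialGelfandPair
import Literature.NumberTheory.Automorphic.SymplecticCartanIwasawaUniqueness
import HarnessLib

/-!
# The `w₀`-symmetry of the Satake transforms of `Sp_{2n}`: for every `T ∈ ℋ(Sp_{2n}(K), Sp_{2n}(𝒪); R)` the coefficients of
# `x^μ` and `x^{-μ}` in `𝒮(T)` agree up to the modulus `[B(𝒪) : B(𝒪) ∩ t_μ B(𝒪) t_μ⁻¹] / [t_μB(𝒪)t_μ⁻¹ : B(𝒪) ∩ t_μB(𝒪)t_μ⁻¹]`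
# (Cartier Thm. 4.1 for `w₀ = -1 ∈ W(C_n)`; Laumon (4.1.4)–(4.1.6); Andrianov–Zhuravlev Ch. 3 §3.3)

Topic `NumberTheory/Automorphic`; namespace `Literature.NumberTheory.Automorphic.SymplecticCartan` (lane `lit-hodgefound`,
Track 2 foundations; seat `lit-hodgefound-p11`, generation 44, row g44-#4).  THEOREMS ONLY: no definition, no named fact, no
instance, no notation.  The `Sp_{2n}` instance of the abstract duality `SatakeTransformDuality` (g44-#1) for the Iwasawa datum
`(B(K), Sp(J, 𝒪), a)` of `SymplecticSatakeTransform` (`isIwasawaExponent_symplectic`).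

## The mathematics

`G = Sp(J, K)` (`K` a field with `Valued K ℤᵐ⁰`, uniformiser `ϖ`), `K₀ = Sp(J, 𝒪)`, `P = B(K)` the Borel of
`SymplecticGroupIwasawa` (block triangular for the Borel order `inr 0 < ⋯ < inr (n-1) < inl (n-1) < ⋯ < inl 0`),
`a = symplecticIwasawaExp` (`a(p)ᵢ = ord p_{inl i, inl i}`), `K_P = B(K) ∩ Sp(J, 𝒪) = B(𝒪)`.  Torus elements
`t_μ = diag(ϖ^{μ} on inl; ϖ^{-μ} on inr)` (`μ ∈ ℤⁿ`, `a(t_μ) = μ`); conjugation by `t_μ` multiplies the entry `(s, s')` by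
`ϖ^{ε(s) - ε(s')}`, `ε = (μ; -μ)`.  Two inputs:

1. **Relative unimodularity** (§2): for `μ` MONOTONE and `≤ 0` the element `t_μ` contracts `B(𝒪)` (`ε(s) ≥ ε(s')` whenever
   `s ≤ s'` in the Borel order), and for `μ₀ = (i - n)_i` (strictly monotone, `< 0`) every `y ∈ B(K)` with `a(y) = 0` (unit
   diagonal, arbitrary entries above) is conjugated into `Sp(J, 𝒪)` by a power of `t_{μ₀}`; so g44-#1 §7 applies
   (`exists_subgroup_relIndex_ne_zero_symplectic`).
2. **Every double coset is self-inverse** (§3): `g⁻¹ ∈ K₀ g K₀` (tree: `inv_mem_doubleCoset_symplecticInt`, from `J t J⁻¹ = t⁻¹`,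
   i.e. `-1 ∈ W(C_n)`), so `T_{g⁻¹} = T_g` (`doubleCosetOperator_inv_symplectic`).

Consequently (§4), for every commutative ring `R`, every `T ∈ ℋ(Sp(J, K), Sp(J, 𝒪); R)` and every `μ ∈ ℤⁿ`:

  `𝒮_1(T)_μ · [t_μK_Pt_μ⁻¹ : K_P ∩ t_μK_Pt_μ⁻¹] = 𝒮_1(T)_{-μ} · [K_P : K_P ∩ t_μK_Pt_μ⁻¹]`   (`coeff_satakeTransform_one_mul_relIndex_eq_symplectic`),

for `μ` monotone `≤ 0` (antidominant; `t_μ` contracting): **`𝒮_1(T)_μ = [K_P : t_μK_Pt_μ⁻¹] · 𝒮_1(T)_{-μ}`** — the coefficient at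
an antidominant exponent is the modulus index times the coefficient at the opposite dominant one
(`coeff_satakeTransform_one_eq_relIndex_mul_symplectic`); the same for Cartier's normalisation `𝒮_q` (weight `q^{⟨ρ, a⟩}`,
`symplecticSatakeTransform`): `𝒮_q(T)_μ · q^{⟨ρ,-μ⟩} · [⋯] = 𝒮_q(T)_{-μ} · q^{⟨ρ,μ⟩} · [⋯]`
(`coeff_symplecticSatakeTransform_mul_relIndex_eq`), and `𝒮_w(T) = ι(𝒮_{w'}(T))` (`ι(x^μ) = x^{-μ}`) for any pair of weights
absorbing the modulus (`satakeTransform_eq_domCongr_neg_symplectic`).  This is the `w₀ = -1` part of «`𝒮` is an isomorphism onto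
`ℂ[Λ]^W`» (Cartier Thm. 4.1) for `Sp_{2n}`, over any `R`, with the modulus kept as an index; for `n = 1` (`SL₂`, `W = {1, w₀}`)
it is the whole `W`-invariance: e.g. `𝒮_q(T_{diag(ϖ; ϖ⁻¹)}) = q x + (q - 1) + q x⁻¹`.

## What is formalised (theorems only)

* §1 torus elements `t` with `(t : Matrix) = diagonal (ϖ^{(μ; -μ)})`: `exists_coe_eq_diagonal_zpow_symplectic`,
  `mem_symplecticBorel_of_coe_eq_diagonal`, `symplecticIwasawaExp_of_coe_eq_diagonal_zpow` (`a(t_μ) = μ`),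
  `coe_inv_of_coe_eq_diagonal_zpow`, `coe_pow_of_coe_eq_diagonal_zpow`, **`coe_conj_apply_of_coe_eq_diagonal_zpow`**
  (`(t x t⁻¹)_{s s'} = ϖ^{ε s - ε s'} x_{s s'}`).
* §2 `elim_sub_elim_nonneg_of_symplecticBorelOrder_le`, `one_le_elim_sub_elim_of_symplecticBorelOrder_lt`,
  `exists_forall_v_zpow_mul_apply_le_one`, `v_apply_eq_one_of_symplecticIwasawaExp_eq_zero` (unit diagonal on `B ∩ a⁻¹(0)`),
  **`conjAct_smul_inf_le_of_monotone_nonpos_symplectic`** (antidominant torus elements contract `B(𝒪)`),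
  **`exists_conj_pow_mem_symplecticInt`**, **`exists_subgroup_relIndex_ne_zero_symplectic`**.
* §3 `orbit_inv_eq_orbit_symplectic`, **`doubleCosetOperator_inv_symplectic`** (`T_{g⁻¹} = T_g`).
* §3' `coe_inv_eq_diagonal_zpow_neg`, `inf_le_conjAct_smul_of_antitone_nonneg_symplectic` (dominant `t_μ` EXPAND `B(𝒪)`),
  `coe_diagonal_pow_eq_diagonal_zpow` (the tree's Cartan representatives `d(a)`, `a ∈ ℕⁿ`, in the normal form).
* §4 **`card_filter_symplecticIwasawaExp_mul_relIndex_eq`**, **`coeff_satakeTransform_one_mul_relIndex_eq_symplectic`**,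
  **`coeff_satakeTransform_one_eq_relIndex_mul_symplectic`**, `coeff_satakeTransform_mul_relIndex_eq_symplectic` (any weight),
  **`coeff_symplecticSatakeTransform_mul_relIndex_eq`** (Cartier's `q^{⟨ρ,·⟩}`), **`satakeTransform_eq_domCongr_neg_symplectic`**,
  `domCongr_neg_satakeTransform_eq_self_symplectic`, **`card_filter_symplecticIwasawaExp_orbit_neg_eq_relIndex`** (the
  dominant-extreme count `#{γ ∈ K₀d(a)K₀/K₀ : a(γ) = -a} = [d(a)B(𝒪)d(a)⁻¹ : B(𝒪)]`, from the tree's `#{γ : a(γ) = a} = 1`).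

## References
* [CartierCorvallis1979] P. Cartier, *Representations of 𝔭-adic groups: a survey*, PSPM 33.1 (1979), §I.3, §IV (4.2), Thm. 4.1.
* [Laumon1995] G. Laumon, *Cohomology of Drinfeld Modular Varieties I*, CUP, (4.1.4)–(4.1.6).
* [AndrianovZhuravlev1995] A. N. Andrianov, V. G. Zhuravlev, *Modular Forms and Hecke Operators*, Transl. Math. Monogr. 145,
  Ch. 3 §3 Lemma 3.6, Thm. 3.7, §3.3 (3.44)–(3.49).
* [BruhatTits1972] F. Bruhat, J. Tits, *Groupes réductifs sur un corps local I*, Publ. Math. IHÉS 41 (1972), (4.4.3), (4.4.4).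
* [Tits1979] J. Tits, *Reductive groups over local fields*, PSPM 33.1 (1979), §3.3.3.
-/

noncomputable section

open scoped Valued WithZero Pointwise
open Matrix MonoidAlgebra Representation Finset MulAction ConjAct

namespace Literature.NumberTheory.Automorphic.SymplecticCartan

open Literature.NumberTheory.Automorphic.CartanUnique Literature.NumberTheory.Automorphic.HermitianLattice

variable {K : Type*} [Field K] [Valued K ℤᵐ⁰] {ϖ : K} {n : ℕ}

/-! ## §1 Torus elements `t_μ = diag(ϖ^{μ}; ϖ^{-μ})` with `μ ∈ ℤⁿ` -/

omit [Valued K ℤᵐ⁰] in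
/-- `ϖ^{μ i} ϖ^{-μ i} = 1`: the diagonal `(ϖ^{μ}; ϖ^{-μ})` is symplectic. [cite: AndrianovZhuravlev1995, Ch. 3 §3 Lemma 3.6] -/
theorem zpow_elim_inl_mul_inr (hϖ0 : ϖ ≠ 0) (μ : Fin n → ℤ) (i : Fin n) :
    (fun s : Fin n ⊕ Fin n => ϖ ^ Sum.elim μ (-μ) s) (Sum.inl i) * (fun s : Fin n ⊕ Fin n => ϖ ^ Sum.elim μ (-μ) s) (Sum.inr i) = 1 := by
  simp only [Sum.elim_inl, Sum.elim_inr, Pi.neg_apply]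
  rw [← zpow_add₀ hϖ0, add_neg_cancel, zpow_zero]

omit [Valued K ℤᵐ⁰] in
/-- **Existence of `t_μ ∈ Sp(J, K)` with matrix `diag(ϖ^{μ}; ϖ^{-μ})`**, for every `μ ∈ ℤⁿ`.
[cite: AndrianovZhuravlev1995, Ch. 3 §3 Lemma 3.6] [cite: BruhatTits1972, (4.4.3)] -/
theorem exists_coe_eq_diagonal_zpow_symplectic (hϖ0 : ϖ ≠ 0) (μ : Fin n → ℤ) :
    ∃ t : symplecticGroup (Fin n) K,
      (t : Matrix (Fin n ⊕ Fin n) (Fin n ⊕ Fin n) K) = Matrix.diagonal fun s => ϖ ^ Sum.elim μ (-μ) s :=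
  ⟨⟨_, diagonal_mem_symplecticGroup (zpow_elim_inl_mul_inr hϖ0 μ)⟩, rfl⟩

omit [Valued K ℤᵐ⁰] in
/-- A diagonal element of `Sp(J, K)` lies in the Borel `B(K)`. [cite: AndrianovZhuravlev1995, Ch. 1 §3 Prop. 3.7] -/
theorem mem_symplecticBorel_of_coe_eq_diagonal {t : symplecticGroup (Fin n) K} {d : Fin n ⊕ Fin n → K}
    (ht : (t : Matrix (Fin n ⊕ Fin n) (Fin n ⊕ Fin n) K) = Matrix.diagonal d) : t ∈ symplecticBorel n K := by
  rw [mem_symplecticBorel_iff, ht]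
  exact Matrix.blockTriangular_diagonal _

/-- **`a(t_μ) = μ`**. [cite: BruhatTits1972, (4.4.3)] [cite: AndrianovZhuravlev1995, Ch. 3 §3 Lemma 3.6] -/
theorem symplecticIwasawaExp_of_coe_eq_diagonal_zpow (hϖ : Valued.v ϖ = WithZero.exp (-1 : ℤ)) {t : symplecticGroup (Fin n) K}
    {μ : Fin n → ℤ} (ht : (t : Matrix (Fin n ⊕ Fin n) (Fin n ⊕ Fin n) K) = Matrix.diagonal fun s => ϖ ^ Sum.elim μ (-μ) s) :
    symplecticIwasawaExp hϖ t = μ := by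
  funext i
  rw [symplecticIwasawaExp_of_mem_symplecticBorel hϖ (mem_symplecticBorel_of_coe_eq_diagonal ht) i, ht,
    Matrix.diagonal_apply_eq, Sum.elim_inl, v_uniformizer_zpow hϖ, WithZero.log_exp, neg_neg]

omit [Valued K ℤᵐ⁰] in
/-- The matrix of `t_μ⁻¹` is `diag(ϖ^{-μ}; ϖ^{μ})`. [cite: AndrianovZhuravlev1995, Ch. 3 §3 Lemma 3.6] -/
theorem coe_inv_of_coe_eq_diagonal_zpow (hϖ0 : ϖ ≠ 0) {t : symplecticGroup (Fin n) K} {μ : Fin n → ℤ}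
    (ht : (t : Matrix (Fin n ⊕ Fin n) (Fin n ⊕ Fin n) K) = Matrix.diagonal fun s => ϖ ^ Sum.elim μ (-μ) s) :
    ((t⁻¹ : symplecticGroup (Fin n) K) : Matrix (Fin n ⊕ Fin n) (Fin n ⊕ Fin n) K) =
      Matrix.diagonal fun s => ϖ ^ (-Sum.elim μ (-μ) s) := by
  rw [SymplecticGroup.coe_inv', ht]
  refine Matrix.inv_eq_left_inv ?_
  rw [Matrix.diagonal_mul_diagonal, ← Matrix.diagonal_one]
  congr 1
  funext s
  rw [← zpow_add₀ hϖ0, neg_add_cancel, zpow_zero]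

omit [Valued K ℤᵐ⁰] in
/-- The matrix of `t_μ ^ k` is `diag(ϖ^{kμ}; ϖ^{-kμ})`. [cite: AndrianovZhuravlev1995, Ch. 3 §3 Lemma 3.6] -/
theorem coe_pow_of_coe_eq_diagonal_zpow (hϖ0 : ϖ ≠ 0) {t : symplecticGroup (Fin n) K} {μ : Fin n → ℤ}
    (ht : (t : Matrix (Fin n ⊕ Fin n) (Fin n ⊕ Fin n) K) = Matrix.diagonal fun s => ϖ ^ Sum.elim μ (-μ) s) (k : ℕ) :
    ((t ^ k : symplecticGroup (Fin n) K) : Matrix (Fin n ⊕ Fin n) (Fin n ⊕ Fin n) K) =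
      Matrix.diagonal fun s => ϖ ^ Sum.elim ((k : ℤ) • μ) (-((k : ℤ) • μ)) s := by
  induction k with
  | zero =>
    rw [pow_zero, OneMemClass.coe_one, ← Matrix.diagonal_one]
    congr 1
    funext s
    rcases s with i | i <;> simp
  | succ k ih =>
    rw [pow_succ, Submonoid.coe_mul, ih, ht, Matrix.diagonal_mul_diagonal]
    congr 1
    funext s
    rw [← zpow_add₀ hϖ0]
    congr 1
    rcases s with i | i
    · simp only [Sum.elim_inl, Pi.smul_apply, smul_eq_mul]; push_cast; ring
    · simp only [Sum.elim_inr, Pi.neg_apply, Pi.smul_apply, smul_eq_mul]; push_cast; ring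

omit [Valued K ℤᵐ⁰] in
/-- **Entries of a conjugate by `t_μ`**: `(t_μ x t_μ⁻¹)_{s s'} = ϖ^{ε(s) - ε(s')} x_{s s'}`, `ε = (μ; -μ)`.
[cite: BruhatTits1972, (4.4.4) (ii)] -/
theorem coe_conj_apply_of_coe_eq_diagonal_zpow (hϖ0 : ϖ ≠ 0) {t : symplecticGroup (Fin n) K} {μ : Fin n → ℤ}
    (ht : (t : Matrix (Fin n ⊕ Fin n) (Fin n ⊕ Fin n) K) = Matrix.diagonal fun s => ϖ ^ Sum.elim μ (-μ) s)
    (x : symplecticGroup (Fin n) K) (s s' : Fin n ⊕ Fin n) :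
    ((t * x * t⁻¹ : symplecticGroup (Fin n) K) : Matrix (Fin n ⊕ Fin n) (Fin n ⊕ Fin n) K) s s' =
      ϖ ^ (Sum.elim μ (-μ) s - Sum.elim μ (-μ) s') * (x : Matrix (Fin n ⊕ Fin n) (Fin n ⊕ Fin n) K) s s' := by
  rw [Submonoid.coe_mul, Submonoid.coe_mul, coe_inv_of_coe_eq_diagonal_zpow hϖ0 ht, ht, Matrix.mul_diagonal,
    Matrix.diagonal_mul, zpow_sub₀ hϖ0, _root_.zpow_neg, div_eq_mul_inv]
  ring

/-! ## §2 Relative unimodularity of `B(K) ∩ a⁻¹(0)` with respect to `B(𝒪)` -/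

/-- For `μ` monotone and `≤ 0`, the exponent `ε = (μ; -μ)` is ANTITONE for the Borel order:
`o(s) ≤ o(s') ⇒ ε(s') ≤ ε(s)`. [cite: BruhatTits1972, (4.4.4)] -/
theorem elim_sub_elim_nonneg_of_symplecticBorelOrder_le {μ : Fin n → ℤ} (hμ : Monotone μ) (hμ0 : ∀ i, μ i ≤ 0)
    {s s' : Fin n ⊕ Fin n} (h : symplecticBorelOrder n s ≤ symplecticBorelOrder n s') :
    0 ≤ Sum.elim μ (-μ) s - Sum.elim μ (-μ) s' := by
  rcases s with i | i <;> rcases s' with j | j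
  · simp only [symplecticBorelOrder_inl] at h
    simp only [Sum.elim_inl, sub_nonneg]
    have hi := i.2; have hj := j.2
    exact hμ (show j ≤ i from Fin.le_def.2 (by omega))
  · simp only [symplecticBorelOrder_inl, symplecticBorelOrder_inr] at h
    have hi := i.2; have hj := j.2
    omega
  · simp only [Sum.elim_inr, Sum.elim_inl, Pi.neg_apply]
    have h1 := hμ0 i; have h2 := hμ0 j
    omega
  · simp only [symplecticBorelOrder_inr] at h
    simp only [Sum.elim_inr, Pi.neg_apply]
    have := hμ (show i ≤ j from Fin.le_def.2 h)
    omega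

/-- For `μ` STRICTLY monotone and `< 0`, `ε = (μ; -μ)` strictly decreases along the Borel order:
`o(s) < o(s') ⇒ ε(s) - ε(s') ≥ 1`. [cite: BruhatTits1972, (4.4.4)] -/
theorem one_le_elim_sub_elim_of_symplecticBorelOrder_lt {μ : Fin n → ℤ} (hμ : StrictMono μ) (hμ0 : ∀ i, μ i < 0)
    {s s' : Fin n ⊕ Fin n} (h : symplecticBorelOrder n s < symplecticBorelOrder n s') :
    1 ≤ Sum.elim μ (-μ) s - Sum.elim μ (-μ) s' := by
  rcases s with i | i <;> rcases s' with j | j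
  · have hij : j < i := symplecticBorelOrder_inl_lt_inl.1 h
    simp only [Sum.elim_inl]
    have := hμ hij
    omega
  · simp only [symplecticBorelOrder_inl, symplecticBorelOrder_inr] at h
    have hi := i.2; have hj := j.2
    omega
  · simp only [Sum.elim_inr, Sum.elim_inl, Pi.neg_apply]
    have h1 := hμ0 i; have h2 := hμ0 j
    omega
  · have hij : i < j := symplecticBorelOrder_inr_lt_inr.1 h
    simp only [Sum.elim_inr, Pi.neg_apply]
    have := hμ hij
    omega

/-- All entries of a matrix become integral after multiplication by `ϖ^m`, `m ≥ k`, for one `k`.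
[cite: CartierCorvallis1979, §IV (4.2)] -/
theorem exists_forall_v_zpow_mul_apply_le_one (hϖ : Valued.v ϖ = WithZero.exp (-1 : ℤ)) {ι : Type*} [Finite ι]
    (M : Matrix ι ι K) : ∃ k : ℕ, ∀ s s', ∀ m : ℤ, (k : ℤ) ≤ m → Valued.v (ϖ ^ m * M s s') ≤ 1 := by
  classical
  haveI := Fintype.ofFinite ι
  -- one entry
  have one : ∀ x : K, ∃ k : ℕ, ∀ m : ℤ, (k : ℤ) ≤ m → Valued.v (ϖ ^ m * x) ≤ 1 := by
    intro x
    by_cases hx : x = 0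
    · exact ⟨0, fun m _ => by rw [hx, mul_zero, map_zero]; exact zero_le⟩
    have hvx : Valued.v x ≠ 0 := (Valuation.ne_zero_iff _).2 hx
    refine ⟨(WithZero.log (Valued.v x)).toNat, fun m hm => ?_⟩
    rw [map_mul, v_uniformizer_zpow hϖ, ← WithZero.exp_log hvx, ← WithZero.exp_add, ← WithZero.exp_zero, WithZero.exp_le_exp]
    have := Int.self_le_toNat (WithZero.log (Valued.v x))
    omega
  choose k hk using fun p : ι × ι => one (M p.1 p.2)
  exact ⟨Finset.univ.sup k, fun s s' m hm => hk (s, s') m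
    ((Int.ofNat_le.2 (Finset.le_sup (f := k) (Finset.mem_univ (s, s')))).trans hm)⟩

/-- **Unit diagonal on `B(K) ∩ a⁻¹(0)`**: if `y ∈ B(K)` and `a(y) = 0` then every diagonal entry of `y` has valuation `1`.
[cite: BruhatTits1972, (4.4.3)] [cite: AndrianovZhuravlev1995, Ch. 3 §3.3 (3.44)] -/
theorem v_apply_eq_one_of_symplecticIwasawaExp_eq_zero (hϖ : Valued.v ϖ = WithZero.exp (-1 : ℤ))
    {y : symplecticGroup (Fin n) K} (hy : y ∈ symplecticBorel n K) (hay : symplecticIwasawaExp hϖ y = 0) (s : Fin n ⊕ Fin n) :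
    Valued.v ((y : Matrix (Fin n ⊕ Fin n) (Fin n ⊕ Fin n) K) s s) = 1 := by
  have hinl : ∀ i : Fin n, Valued.v ((y : Matrix (Fin n ⊕ Fin n) (Fin n ⊕ Fin n) K) (Sum.inl i) (Sum.inl i)) = 1 := fun i => by
    rw [v_apply_inl_eq_exp_neg hϖ hy (symplecticInt (Fin n) K).one_mem (mul_one y).symm i, hay, Pi.zero_apply, neg_zero,
      WithZero.exp_zero]
  rcases s with i | i
  · exact hinl i
  · have h := congrArg Valued.v (apply_inr_mul_apply_inl_eq_one hy i)
    rwa [map_mul, map_one, hinl i, mul_one] at h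

/-- **Conjugation by an antidominant `t_μ` (`μ` monotone, `≤ 0`) keeps `B(𝒪)` inside `Sp(J, 𝒪)`**: the entry `(s, s')` of
`x ∈ B(K) ∩ Sp(J, 𝒪)` vanishes unless `o(s) ≤ o(s')`, where it is multiplied by `ϖ^{ε(s) - ε(s')}`, `ε(s) ≥ ε(s')`.
[cite: BruhatTits1972, (4.4.4) (ii)] -/
theorem conj_mem_symplecticInt_of_monotone_nonpos (hϖ : Valued.v ϖ = WithZero.exp (-1 : ℤ)) {t : symplecticGroup (Fin n) K}
    {μ : Fin n → ℤ} (ht : (t : Matrix (Fin n ⊕ Fin n) (Fin n ⊕ Fin n) K) = Matrix.diagonal fun s => ϖ ^ Sum.elim μ (-μ) s)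
    (hμ : Monotone μ) (hμ0 : ∀ i, μ i ≤ 0) {x : symplecticGroup (Fin n) K} (hxP : x ∈ symplecticBorel n K)
    (hxK : x ∈ symplecticInt (Fin n) K) : t * x * t⁻¹ ∈ symplecticInt (Fin n) K := by
  rw [mem_symplecticInt_iff] at hxK ⊢
  intro s s'
  rw [coe_conj_apply_of_coe_eq_diagonal_zpow (uniformizer_ne_zero hϖ) ht]
  rcases lt_or_ge (symplecticBorelOrder n s') (symplecticBorelOrder n s) with hlt | hle
  · rw [mem_symplecticBorel_iff.1 hxP hlt, mul_zero, map_zero]; exact zero_le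
  · rw [map_mul, v_uniformizer_zpow hϖ, ← one_mul (1 : ℤᵐ⁰)]
    refine mul_le_mul' ?_ (hxK s s')
    rw [← WithZero.exp_zero, WithZero.exp_le_exp, neg_nonpos]
    exact elim_sub_elim_nonneg_of_symplecticBorelOrder_le hμ hμ0 hle

/-- **`t_μ B(𝒪) t_μ⁻¹ ≤ B(𝒪)` for `μ` monotone `≤ 0`** (`B(𝒪) = B(K) ∩ Sp(J, 𝒪)`): antidominant torus elements contract.
[cite: CartierCorvallis1979, §IV (4.2)] [cite: BruhatTits1972, (4.4.4) (ii)] -/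
theorem conjAct_smul_inf_le_of_monotone_nonpos_symplectic (hϖ : Valued.v ϖ = WithZero.exp (-1 : ℤ))
    {t : symplecticGroup (Fin n) K} {μ : Fin n → ℤ}
    (ht : (t : Matrix (Fin n ⊕ Fin n) (Fin n ⊕ Fin n) K) = Matrix.diagonal fun s => ϖ ^ Sum.elim μ (-μ) s)
    (hμ : Monotone μ) (hμ0 : ∀ i, μ i ≤ 0) :
    toConjAct t • (symplecticBorel n K ⊓ symplecticInt (Fin n) K) ≤ symplecticBorel n K ⊓ symplecticInt (Fin n) K := by
  have htP : t ∈ symplecticBorel n K := mem_symplecticBorel_of_coe_eq_diagonal ht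
  intro y hy
  rw [Subgroup.mem_pointwise_smul_iff_inv_smul_mem, ← toConjAct_inv, toConjAct_inv_smul] at hy
  obtain ⟨hyP, hyK⟩ := Subgroup.mem_inf.1 hy
  have e : y = t * (t⁻¹ * y * t) * t⁻¹ := by group
  refine Subgroup.mem_inf.2 ⟨?_, ?_⟩
  · rw [e]
    exact (symplecticBorel n K).mul_mem ((symplecticBorel n K).mul_mem htP hyP) ((symplecticBorel n K).inv_mem htP)
  · rw [e]
    exact conj_mem_symplecticInt_of_monotone_nonpos hϖ ht hμ hμ0 hyP hyK

/-- **A power of a strictly antidominant `t_μ` (`μ` strictly monotone, `< 0`) conjugates every `y ∈ B(K)` with `a(y) = 0`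
into `Sp(J, 𝒪)`**: the entry `(s, s')`, `o(s) < o(s')`, of `t_μᵏ y t_μ⁻ᵏ` is `ϖ^{k(ε(s) - ε(s'))} y_{s s'}` with
`ε(s) - ε(s') ≥ 1`, the diagonal entries are units, the rest vanish. [cite: CartierCorvallis1979, §IV (4.2)] -/
theorem exists_conj_pow_mem_symplecticInt (hϖ : Valued.v ϖ = WithZero.exp (-1 : ℤ)) {t : symplecticGroup (Fin n) K}
    {μ : Fin n → ℤ} (ht : (t : Matrix (Fin n ⊕ Fin n) (Fin n ⊕ Fin n) K) = Matrix.diagonal fun s => ϖ ^ Sum.elim μ (-μ) s)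
    (hμ : StrictMono μ) (hμ0 : ∀ i, μ i < 0) {y : symplecticGroup (Fin n) K} (hy : y ∈ symplecticBorel n K)
    (hay : symplecticIwasawaExp hϖ y = 0) : ∃ k : ℕ, toConjAct (t ^ k) • y ∈ symplecticInt (Fin n) K := by
  have hϖ0 := uniformizer_ne_zero hϖ
  obtain ⟨k, hk⟩ := exists_forall_v_zpow_mul_apply_le_one hϖ (y : Matrix (Fin n ⊕ Fin n) (Fin n ⊕ Fin n) K)
  refine ⟨k, ?_⟩
  rw [toConjAct_smul, mem_symplecticInt_iff]
  intro s s'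
  rw [coe_conj_apply_of_coe_eq_diagonal_zpow hϖ0 (coe_pow_of_coe_eq_diagonal_zpow hϖ0 ht k)]
  rcases lt_trichotomy (symplecticBorelOrder n s') (symplecticBorelOrder n s) with hlt | heq | hgt
  · rw [mem_symplecticBorel_iff.1 hy hlt, mul_zero, map_zero]; exact zero_le
  · have hss' : s = s' := symplecticBorelOrder_injective heq.symm
    subst hss'
    rw [sub_self, zpow_zero, one_mul, v_apply_eq_one_of_symplecticIwasawaExp_eq_zero hϖ hy hay]
  · have h1 := one_le_elim_sub_elim_of_symplecticBorelOrder_lt hμ hμ0 hgt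
    have hexp : Sum.elim ((k : ℤ) • μ) (-((k : ℤ) • μ)) s - Sum.elim ((k : ℤ) • μ) (-((k : ℤ) • μ)) s' =
        (k : ℤ) * (Sum.elim μ (-μ) s - Sum.elim μ (-μ) s') := by
      rcases s with i | i <;> rcases s' with j | j <;>
        simp only [Sum.elim_inl, Sum.elim_inr, Pi.neg_apply, Pi.smul_apply, smul_eq_mul] <;> ring
    rw [hexp]
    exact hk s s' _ (by nlinarith)

/-- **THE RELATIVE UNIMODULARITY HYPOTHESIS FOR `Sp_{2n}`**: every `y ∈ B(K)` with `a(y) = 0` lies in a subgroup `V ⊇ B(𝒪)`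
with `[V : B(𝒪)] < ∞` (`V = t₀⁻ᵏ B(𝒪) t₀ᵏ`, `t₀ = t_{(i-n)_i}`). [cite: CartierCorvallis1979, §I.3, §IV (4.2)] -/
theorem exists_subgroup_relIndex_ne_zero_symplectic (hϖ : Valued.v ϖ = WithZero.exp (-1 : ℤ))
    [IsHeckeTriple (⊤ : Submonoid (symplecticGroup (Fin n) K)) (symplecticInt (Fin n) K) (symplecticInt (Fin n) K)] :
    ∀ y ∈ symplecticBorel n K, symplecticIwasawaExp hϖ y = 0 →
      ∃ V : Subgroup (symplecticGroup (Fin n) K), y ∈ V ∧ symplecticBorel n K ⊓ symplecticInt (Fin n) K ≤ V ∧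
        (symplecticBorel n K ⊓ symplecticInt (Fin n) K).relIndex V ≠ 0 := by
  have hϖ0 := uniformizer_ne_zero hϖ
  obtain ⟨t, ht⟩ := exists_coe_eq_diagonal_zpow_symplectic (K := K) hϖ0 (fun i : Fin n => (i : ℤ) - n)
  have hμ : StrictMono (fun i : Fin n => (i : ℤ) - n) := fun i j hij => by
    have : (i : ℕ) < (j : ℕ) := hij
    simp only; omega
  have hμ0 : ∀ i : Fin n, (fun i : Fin n => (i : ℤ) - n) i < 0 := fun i => by have := i.2; simp only; omega
  exact IsIwasawaExponent.exists_subgroup_relIndex_ne_zero_of_contracting (a := symplecticIwasawaExp hϖ)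
    (mem_symplecticBorel_of_coe_eq_diagonal ht)
    (conjAct_smul_inf_le_of_monotone_nonpos_symplectic hϖ ht hμ.monotone fun i => (hμ0 i).le)
    fun y hy hay => exists_conj_pow_mem_symplecticInt hϖ ht hμ hμ0 hy hay

/-! ## §3 Every double coset of `(Sp(J, K), Sp(J, 𝒪))` is self-inverse -/

/-- **`K₀ g⁻¹ K₀ = K₀ g K₀`** for every `g ∈ Sp(J, K)` (`-1 ∈ W(C_n)`: `J t J⁻¹ = t⁻¹` on the torus; tree
`inv_mem_doubleCoset_symplecticInt`). [cite: AndrianovZhuravlev1995, Ch. 3 §3, proof of Thm. 3.7] [cite: Tits1979, §3.3.3] -/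
theorem orbit_inv_eq_orbit_symplectic (hϖ : Valued.v ϖ = WithZero.exp (-1 : ℤ)) (g : symplecticGroup (Fin n) K) :
    MulAction.orbit (symplecticInt (Fin n) K)
        ((g⁻¹ : symplecticGroup (Fin n) K) : symplecticGroup (Fin n) K ⧸ symplecticInt (Fin n) K) =
      MulAction.orbit (symplecticInt (Fin n) K) (g : symplecticGroup (Fin n) K ⧸ symplecticInt (Fin n) K) := by
  obtain ⟨x, hx, y, hy, e⟩ := DoubleCoset.mem_doubleCoset.1 (inv_mem_doubleCoset_symplecticInt hϖ g)
  exact MulAction.orbit_eq_iff.2 ((heckeAlgebra.coe_mem_orbit_coe_iff _ _ _).2 ⟨x, hx, y, hy, e⟩)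

/-- **`T_{g⁻¹} = T_g` in `ℋ(Sp(J, K), Sp(J, 𝒪); R)`** for every `g`. [cite: AndrianovZhuravlev1995, Ch. 3 §3 Thm. 3.7]
[cite: CartierCorvallis1979, §IV Thm. 4.1] -/
theorem doubleCosetOperator_inv_symplectic {R : Type*} [CommRing R] (hϖ : Valued.v ϖ = WithZero.exp (-1 : ℤ))
    [IsHeckeTriple (⊤ : Submonoid (symplecticGroup (Fin n) K)) (symplecticInt (Fin n) K) (symplecticInt (Fin n) K)]
    (g : symplecticGroup (Fin n) K) :
    heckeAlgebra.doubleCosetOperator (k := R) (symplecticInt (Fin n) K) g⁻¹ =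
      heckeAlgebra.doubleCosetOperator (k := R) (symplecticInt (Fin n) K) g :=
  heckeAlgebra.doubleCosetOperator_eq_of_orbit_eq _ (orbit_inv_eq_orbit_symplectic hϖ g)

/-- The matrix of `t⁻¹` in the normal form `diagonal (ϖ^{(-μ; μ)})`. [cite: AndrianovZhuravlev1995, Ch. 3 §3 Lemma 3.6] -/
theorem coe_inv_eq_diagonal_zpow_neg (hϖ : Valued.v ϖ = WithZero.exp (-1 : ℤ)) {t : symplecticGroup (Fin n) K} {μ : Fin n → ℤ}
    (ht : (t : Matrix (Fin n ⊕ Fin n) (Fin n ⊕ Fin n) K) = Matrix.diagonal fun s => ϖ ^ Sum.elim μ (-μ) s) :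
    ((t⁻¹ : symplecticGroup (Fin n) K) : Matrix (Fin n ⊕ Fin n) (Fin n ⊕ Fin n) K) =
      Matrix.diagonal fun s => ϖ ^ Sum.elim (-μ) (-(-μ)) s := by
  rw [coe_inv_of_coe_eq_diagonal_zpow (uniformizer_ne_zero hϖ) ht]
  congr 1
  funext s
  congr 1
  rcases s with i | i <;> simp only [Sum.elim_inl, Sum.elim_inr, Pi.neg_apply]

/-- **Dominant torus elements EXPAND `B(𝒪)`**: for `μ` antitone and `≥ 0`, `B(𝒪) ≤ t_μ B(𝒪) t_μ⁻¹`.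
[cite: BruhatTits1972, (4.4.4) (ii)] -/
theorem inf_le_conjAct_smul_of_antitone_nonneg_symplectic (hϖ : Valued.v ϖ = WithZero.exp (-1 : ℤ))
    {t : symplecticGroup (Fin n) K} {μ : Fin n → ℤ}
    (ht : (t : Matrix (Fin n ⊕ Fin n) (Fin n ⊕ Fin n) K) = Matrix.diagonal fun s => ϖ ^ Sum.elim μ (-μ) s)
    (hμ : Antitone μ) (hμ0 : ∀ i, 0 ≤ μ i) :
    symplecticBorel n K ⊓ symplecticInt (Fin n) K ≤ toConjAct t • (symplecticBorel n K ⊓ symplecticInt (Fin n) K) := by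
  have h := conjAct_smul_inf_le_of_monotone_nonpos_symplectic hϖ (coe_inv_eq_diagonal_zpow_neg hϖ ht) hμ.neg
    (fun i => by simp only [Pi.neg_apply]; have := hμ0 i; omega)
  rw [toConjAct_inv] at h
  have h' := Subgroup.pointwise_smul_le_pointwise_smul_iff (a := toConjAct t) |>.2 h
  rwa [smul_inv_smul] at h'

omit [Valued K ℤᵐ⁰] in
/-- The Cartan representative `d(a) = diag(ϖ^a; ϖ^{-a})` (`a ∈ ℕⁿ`) in the normal form `diagonal (ϖ^{(a; -a)})`.
[cite: AndrianovZhuravlev1995, Ch. 3 §3 Lemma 3.6] -/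
theorem coe_diagonal_pow_eq_diagonal_zpow (hϖ0 : ϖ ≠ 0) (a : Fin n → ℕ) :
    ((⟨Matrix.diagonal (Sum.elim (fun i => ϖ ^ a i) (fun i => (ϖ ^ a i)⁻¹)), diagonal_pow_mem_symplecticGroup hϖ0 a⟩ :
        symplecticGroup (Fin n) K) : Matrix (Fin n ⊕ Fin n) (Fin n ⊕ Fin n) K) =
      Matrix.diagonal fun s => ϖ ^ Sum.elim (fun i => (a i : ℤ)) (-fun i => (a i : ℤ)) s := by
  change Matrix.diagonal _ = _
  congr 1
  funext s
  rcases s with i | i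
  · simp only [Sum.elim_inl, zpow_natCast]
  · simp only [Sum.elim_inr, Pi.neg_apply, _root_.zpow_neg, zpow_natCast]

/-! ## §4 The `w₀`-symmetry of the Satake transforms of `Sp(J, K)` -/

section Duality

variable {R : Type*} [CommRing R]
  [IsHeckeTriple (⊤ : Submonoid (symplecticGroup (Fin n) K)) (symplecticInt (Fin n) K) (symplecticInt (Fin n) K)]

/-- **DUALITY FOR `Sp_{2n}` (counting version)**: for every `g` and `μ ∈ ℤⁿ`,
`#{γ ∈ K₀gK₀/K₀ : a γ = μ} · [t_μK_Pt_μ⁻¹ : K_P ∩ t_μK_Pt_μ⁻¹] = #{γ ∈ K₀gK₀/K₀ : a γ = -μ} · [K_P : K_P ∩ t_μK_Pt_μ⁻¹]`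
(`K_P = B(𝒪)`; the double coset of `g⁻¹` is that of `g`). [cite: CartierCorvallis1979, §IV (4.2), Thm. 4.1]
[cite: Laumon1995, (4.1.4)–(4.1.6)] -/
theorem card_filter_symplecticIwasawaExp_mul_relIndex_eq (hϖ : Valued.v ϖ = WithZero.exp (-1 : ℤ))
    (g : symplecticGroup (Fin n) K) {t : symplecticGroup (Fin n) K} {μ : Fin n → ℤ}
    (ht : (t : Matrix (Fin n ⊕ Fin n) (Fin n ⊕ Fin n) K) = Matrix.diagonal fun s => ϖ ^ Sum.elim μ (-μ) s)
    [DecidablePred fun α : symplecticGroup (Fin n) K ⧸ symplecticInt (Fin n) K => symplecticIwasawaExp hϖ α.out = μ]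
    [DecidablePred fun α : symplecticGroup (Fin n) K ⧸ symplecticInt (Fin n) K => symplecticIwasawaExp hϖ α.out = -μ] :
    ((finite_orbit_quotient (symplecticInt (Fin n) K) g).toFinset.filter
          (fun α => symplecticIwasawaExp hϖ α.out = μ)).card *
        (symplecticBorel n K ⊓ symplecticInt (Fin n) K).relIndex
          (toConjAct t • (symplecticBorel n K ⊓ symplecticInt (Fin n) K)) =
      ((finite_orbit_quotient (symplecticInt (Fin n) K) g).toFinset.filter
          (fun α => symplecticIwasawaExp hϖ α.out = -μ)).card *
        (toConjAct t • (symplecticBorel n K ⊓ symplecticInt (Fin n) K)).relIndex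
          (symplecticBorel n K ⊓ symplecticInt (Fin n) K) := by
  classical
  have ha := symplecticIwasawaExp_of_coe_eq_diagonal_zpow hϖ ht
  have key := (isIwasawaExponent_symplectic hϖ).card_filter_mul_relIndex_eq (exists_subgroup_relIndex_ne_zero_symplectic hϖ) g
    (mem_symplecticBorel_of_coe_eq_diagonal ht)
  simp only [ha] at key
  have horb : (finite_orbit_quotient (symplecticInt (Fin n) K) g⁻¹).toFinset =
      (finite_orbit_quotient (symplecticInt (Fin n) K) g).toFinset := by
    ext γ
    rw [Set.Finite.mem_toFinset, Set.Finite.mem_toFinset, orbit_inv_eq_orbit_symplectic hϖ g]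
  rw [horb] at key
  convert key using 2

/-- **THE `w₀`-SYMMETRY OF THE COUNTING TRANSFORM OF EVERY HECKE OPERATOR ON `Sp_{2n}`**: for every commutative ring `R`, every
`T ∈ ℋ(Sp(J, K), Sp(J, 𝒪); R)` and every `μ ∈ ℤⁿ`,
`𝒮_1(T)_μ · [t_μK_Pt_μ⁻¹ : K_P ∩ t_μK_Pt_μ⁻¹] = 𝒮_1(T)_{-μ} · [K_P : K_P ∩ t_μK_Pt_μ⁻¹]`.
[cite: CartierCorvallis1979, §IV Thm. 4.1] [cite: AndrianovZhuravlev1995, Ch. 3 §3.3 Thm. 3.30] -/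
theorem coeff_satakeTransform_one_mul_relIndex_eq_symplectic (hϖ : Valued.v ϖ = WithZero.exp (-1 : ℤ))
    (T : heckeAlgebra R (symplecticGroup (Fin n) K) (symplecticInt (Fin n) K)) {t : symplecticGroup (Fin n) K}
    {μ : Fin n → ℤ} (ht : (t : Matrix (Fin n ⊕ Fin n) (Fin n ⊕ Fin n) K) = Matrix.diagonal fun s => ϖ ^ Sum.elim μ (-μ) s) :
    ((isIwasawaExponent_symplectic hϖ).satakeTransform (1 : Multiplicative (Fin n → ℤ) →* R) T).coeff μ *
        (((symplecticBorel n K ⊓ symplecticInt (Fin n) K).relIndex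
          (toConjAct t • (symplecticBorel n K ⊓ symplecticInt (Fin n) K)) : ℕ) : R) =
      ((isIwasawaExponent_symplectic hϖ).satakeTransform (1 : Multiplicative (Fin n → ℤ) →* R) T).coeff (-μ) *
        (((toConjAct t • (symplecticBorel n K ⊓ symplecticInt (Fin n) K)).relIndex
          (symplecticBorel n K ⊓ symplecticInt (Fin n) K) : ℕ) : R) := by
  have key := (isIwasawaExponent_symplectic hϖ).coeff_satakeTransform_one_mul_relIndex_eq_of_forall
    (exists_subgroup_relIndex_ne_zero_symplectic hϖ) (fun g => doubleCosetOperator_inv_symplectic (R := R) hϖ g)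
    (mem_symplecticBorel_of_coe_eq_diagonal ht) T
  rw [symplecticIwasawaExp_of_coe_eq_diagonal_zpow hϖ ht] at key
  exact key

/-- **Antidominant exponents**: for `μ` monotone `≤ 0`, `t_μ` contracts `K_P = B(𝒪)` and the first index is `1`, so
`𝒮_1(T)_μ = 𝒮_1(T)_{-μ} · [K_P : t_μ K_P t_μ⁻¹]` — the coefficient at the antidominant `x^μ` is the MODULUS index
`[K_P : t_μK_Pt_μ⁻¹]` times the coefficient at the dominant `x^{-μ}`, for every `T` (e.g. `SL₂`, `T = T_{diag(ϖ;ϖ⁻¹)}`: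
`𝒮_1(T)_{-1} = q² · 𝒮_1(T)_{1} = q²`). [cite: CartierCorvallis1979, §IV Thm. 4.1] [cite: Laumon1995, (4.1.4)] -/
theorem coeff_satakeTransform_one_eq_relIndex_mul_symplectic (hϖ : Valued.v ϖ = WithZero.exp (-1 : ℤ))
    (T : heckeAlgebra R (symplecticGroup (Fin n) K) (symplecticInt (Fin n) K)) {t : symplecticGroup (Fin n) K}
    {μ : Fin n → ℤ} (ht : (t : Matrix (Fin n ⊕ Fin n) (Fin n ⊕ Fin n) K) = Matrix.diagonal fun s => ϖ ^ Sum.elim μ (-μ) s)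
    (hμ : Monotone μ) (hμ0 : ∀ i, μ i ≤ 0) :
    ((isIwasawaExponent_symplectic hϖ).satakeTransform (1 : Multiplicative (Fin n → ℤ) →* R) T).coeff μ =
      ((isIwasawaExponent_symplectic hϖ).satakeTransform (1 : Multiplicative (Fin n → ℤ) →* R) T).coeff (-μ) *
        (((toConjAct t • (symplecticBorel n K ⊓ symplecticInt (Fin n) K)).relIndex
          (symplecticBorel n K ⊓ symplecticInt (Fin n) K) : ℕ) : R) := by
  have h := coeff_satakeTransform_one_mul_relIndex_eq_symplectic (R := R) hϖ T ht
  rwa [Subgroup.relIndex_eq_one.2 (conjAct_smul_inf_le_of_monotone_nonpos_symplectic hϖ ht hμ hμ0), Nat.cast_one,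
    mul_one] at h

/-- The symmetry for ANY weight `w`:
`𝒮_w(T)_μ · w(-μ) · [t_μK_Pt_μ⁻¹ : K_P ∩ t_μK_Pt_μ⁻¹] = 𝒮_w(T)_{-μ} · w(μ) · [K_P : K_P ∩ t_μK_Pt_μ⁻¹]`.
[cite: CartierCorvallis1979, §IV Thm. 4.1] -/
theorem coeff_satakeTransform_mul_relIndex_eq_symplectic (hϖ : Valued.v ϖ = WithZero.exp (-1 : ℤ))
    (w : Multiplicative (Fin n → ℤ) →* R) (T : heckeAlgebra R (symplecticGroup (Fin n) K) (symplecticInt (Fin n) K))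
    {t : symplecticGroup (Fin n) K} {μ : Fin n → ℤ}
    (ht : (t : Matrix (Fin n ⊕ Fin n) (Fin n ⊕ Fin n) K) = Matrix.diagonal fun s => ϖ ^ Sum.elim μ (-μ) s) :
    ((isIwasawaExponent_symplectic hϖ).satakeTransform w T).coeff μ * w (Multiplicative.ofAdd (-μ)) *
        (((symplecticBorel n K ⊓ symplecticInt (Fin n) K).relIndex
          (toConjAct t • (symplecticBorel n K ⊓ symplecticInt (Fin n) K)) : ℕ) : R) =
      ((isIwasawaExponent_symplectic hϖ).satakeTransform w T).coeff (-μ) * w (Multiplicative.ofAdd μ) *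
        (((toConjAct t • (symplecticBorel n K ⊓ symplecticInt (Fin n) K)).relIndex
          (symplecticBorel n K ⊓ symplecticInt (Fin n) K) : ℕ) : R) := by
  have key := (isIwasawaExponent_symplectic hϖ).coeff_satakeTransform_mul_relIndex_eq_of_forall
    (exists_subgroup_relIndex_ne_zero_symplectic hϖ) (fun g => doubleCosetOperator_inv_symplectic (R := R) hϖ g) w
    (mem_symplecticBorel_of_coe_eq_diagonal ht) T
  rw [symplecticIwasawaExp_of_coe_eq_diagonal_zpow hϖ ht] at key
  exact key

/-- **Cartier's normalisation** `𝒮_q` (weight `q^{⟨ρ, a⟩}`, `symplecticSatakeTransform`): for every `T` and `μ`,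
`𝒮_q(T)_μ · q^{⟨ρ,-μ⟩} · [t_μK_Pt_μ⁻¹ : K_P ∩ t_μK_Pt_μ⁻¹] = 𝒮_q(T)_{-μ} · q^{⟨ρ,μ⟩} · [K_P : K_P ∩ t_μK_Pt_μ⁻¹]`.
[cite: CartierCorvallis1979, §IV (4.2), Thm. 4.1] [cite: AndrianovZhuravlev1995, Ch. 3 §3.3 (3.44)–(3.49)] -/
theorem coeff_symplecticSatakeTransform_mul_relIndex_eq (hϖ : Valued.v ϖ = WithZero.exp (-1 : ℤ)) (q : Rˣ)
    (T : heckeAlgebra R (symplecticGroup (Fin n) K) (symplecticInt (Fin n) K)) {t : symplecticGroup (Fin n) K}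
    {μ : Fin n → ℤ} (ht : (t : Matrix (Fin n ⊕ Fin n) (Fin n ⊕ Fin n) K) = Matrix.diagonal fun s => ϖ ^ Sum.elim μ (-μ) s) :
    (symplecticSatakeTransform hϖ q T).coeff μ * ((q ^ symplecticRhoPairing (-μ) : Rˣ) : R) *
        (((symplecticBorel n K ⊓ symplecticInt (Fin n) K).relIndex
          (toConjAct t • (symplecticBorel n K ⊓ symplecticInt (Fin n) K)) : ℕ) : R) =
      (symplecticSatakeTransform hϖ q T).coeff (-μ) * ((q ^ symplecticRhoPairing μ : Rˣ) : R) *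
        (((toConjAct t • (symplecticBorel n K ⊓ symplecticInt (Fin n) K)).relIndex
          (symplecticBorel n K ⊓ symplecticInt (Fin n) K) : ℕ) : R) := by
  rw [symplecticSatakeTransform_eq, ← symplecticSatakeWeight_ofAdd, ← symplecticSatakeWeight_ofAdd]
  exact coeff_satakeTransform_mul_relIndex_eq_symplectic hϖ _ T ht

/-- **`𝒮_w(T) = ι(𝒮_{w'}(T))` for every `T ∈ ℋ(Sp(J, K), Sp(J, 𝒪); R)`**, `ι(x^μ) = x^{-μ}`, for weights `w, w'` absorbing the
modulus (`[K_P : K_P ∩ tK_Pt⁻¹] · w(a t) = [tK_Pt⁻¹ : K_P ∩ tK_Pt⁻¹] · w'(-a t)` on `B(K)`, the former indices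
non-zero-divisors in `R`). [cite: CartierCorvallis1979, §IV Thm. 4.1] -/
theorem satakeTransform_eq_domCongr_neg_symplectic (hϖ : Valued.v ϖ = WithZero.exp (-1 : ℤ))
    (w w' : Multiplicative (Fin n → ℤ) →* R)
    (hw : ∀ t ∈ symplecticBorel n K,
      (((toConjAct t • (symplecticBorel n K ⊓ symplecticInt (Fin n) K)).relIndex
          (symplecticBorel n K ⊓ symplecticInt (Fin n) K) : ℕ) : R) * w (Multiplicative.ofAdd (symplecticIwasawaExp hϖ t)) =
        (((symplecticBorel n K ⊓ symplecticInt (Fin n) K).relIndex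
          (toConjAct t • (symplecticBorel n K ⊓ symplecticInt (Fin n) K)) : ℕ) : R) *
          w' (Multiplicative.ofAdd (-symplecticIwasawaExp hϖ t)))
    (hreg : ∀ t ∈ symplecticBorel n K,
      (((toConjAct t • (symplecticBorel n K ⊓ symplecticInt (Fin n) K)).relIndex
          (symplecticBorel n K ⊓ symplecticInt (Fin n) K) : ℕ) : R) ∈ nonZeroDivisors R)
    (T : heckeAlgebra R (symplecticGroup (Fin n) K) (symplecticInt (Fin n) K)) :
    (isIwasawaExponent_symplectic hϖ).satakeTransform w T =
      AddMonoidAlgebra.domCongr R R (AddEquiv.neg (Fin n → ℤ)) ((isIwasawaExponent_symplectic hϖ).satakeTransform w' T) :=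
  (isIwasawaExponent_symplectic hϖ).satakeTransform_eq_domCongr_neg_of_forall (exists_subgroup_relIndex_ne_zero_symplectic hϖ)
    w w' hw hreg (fun g => doubleCosetOperator_inv_symplectic (R := R) hϖ g) T

/-- With one symmetric weight `w = w'`: **every Satake transform of `Sp(J, K)` is `ι`-invariant.**
[cite: CartierCorvallis1979, §IV Thm. 4.1] -/
theorem domCongr_neg_satakeTransform_eq_self_symplectic (hϖ : Valued.v ϖ = WithZero.exp (-1 : ℤ))
    (w : Multiplicative (Fin n → ℤ) →* R)
    (hw : ∀ t ∈ symplecticBorel n K,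
      (((toConjAct t • (symplecticBorel n K ⊓ symplecticInt (Fin n) K)).relIndex
          (symplecticBorel n K ⊓ symplecticInt (Fin n) K) : ℕ) : R) * w (Multiplicative.ofAdd (symplecticIwasawaExp hϖ t)) =
        (((symplecticBorel n K ⊓ symplecticInt (Fin n) K).relIndex
          (toConjAct t • (symplecticBorel n K ⊓ symplecticInt (Fin n) K)) : ℕ) : R) *
          w (Multiplicative.ofAdd (-symplecticIwasawaExp hϖ t)))
    (hreg : ∀ t ∈ symplecticBorel n K,
      (((toConjAct t • (symplecticBorel n K ⊓ symplecticInt (Fin n) K)).relIndex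
          (symplecticBorel n K ⊓ symplecticInt (Fin n) K) : ℕ) : R) ∈ nonZeroDivisors R)
    (T : heckeAlgebra R (symplecticGroup (Fin n) K) (symplecticInt (Fin n) K)) :
    AddMonoidAlgebra.domCongr R R (AddEquiv.neg (Fin n → ℤ)) ((isIwasawaExponent_symplectic hϖ).satakeTransform w T) =
      (isIwasawaExponent_symplectic hϖ).satakeTransform w T :=
  (satakeTransform_eq_domCongr_neg_symplectic hϖ w w hw hreg T).symm

/-- **The dominant-extreme count of `K₀ d(a) K₀` is the modulus index**: for `a ∈ ℕⁿ` antitone,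
`#{γ ∈ K₀ d(a) K₀ / K₀ : a(γ) = -a} = [d(a) B(𝒪) d(a)⁻¹ : B(𝒪)]` — by duality from the tree's
`#{γ : a(γ) = a} = 1` (Bruhat–Tits (4.4.4) (ii)); e.g. `SL₂`: `#{γ ∈ K₀ diag(ϖ; ϖ⁻¹) K₀/K₀ : a γ = -1} = q²`.
[cite: BruhatTits1972, Prop. (4.4.4) (ii)] [cite: CartierCorvallis1979, §IV (4.2)] -/
theorem card_filter_symplecticIwasawaExp_orbit_neg_eq_relIndex (hϖ : Valued.v ϖ = WithZero.exp (-1 : ℤ)) {a : Fin n → ℕ}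
    (ha : Antitone a)
    [DecidablePred fun γ : symplecticGroup (Fin n) K ⧸ symplecticInt (Fin n) K =>
      symplecticIwasawaExp hϖ γ.out = -fun i => (a i : ℤ)] :
    ((finite_orbit_quotient (symplecticInt (Fin n) K)
        ((⟨Matrix.diagonal (Sum.elim (fun i => ϖ ^ a i) (fun i => (ϖ ^ a i)⁻¹)),
          diagonal_pow_mem_symplecticGroup (uniformizer_ne_zero hϖ) a⟩ : symplecticGroup (Fin n) K))).toFinset.filter
        (fun γ => symplecticIwasawaExp hϖ γ.out = -fun i => (a i : ℤ))).card =
      (symplecticBorel n K ⊓ symplecticInt (Fin n) K).relIndex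
        (toConjAct ((⟨Matrix.diagonal (Sum.elim (fun i => ϖ ^ a i) (fun i => (ϖ ^ a i)⁻¹)),
            diagonal_pow_mem_symplecticGroup (uniformizer_ne_zero hϖ) a⟩ : symplecticGroup (Fin n) K)) •
          (symplecticBorel n K ⊓ symplecticInt (Fin n) K)) := by
  classical
  have ht := coe_diagonal_pow_eq_diagonal_zpow (K := K) (uniformizer_ne_zero hϖ) a
  have hanti : Antitone (fun i => (a i : ℤ)) := fun i j hij => Int.ofNat_le.2 (ha hij)
  have h := card_filter_symplecticIwasawaExp_mul_relIndex_eq hϖ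
    ((⟨Matrix.diagonal (Sum.elim (fun i => ϖ ^ a i) (fun i => (ϖ ^ a i)⁻¹)),
      diagonal_pow_mem_symplecticGroup (uniformizer_ne_zero hϖ) a⟩ : symplecticGroup (Fin n) K)) ht
  rw [card_filter_symplecticIwasawaExp_orbit_eq_one hϖ ha, one_mul,
    Subgroup.relIndex_eq_one.2 (inf_le_conjAct_smul_of_antitone_nonneg_symplectic hϖ ht hanti fun i => Int.natCast_nonneg _),
    mul_one] at h
  convert h.symm using 2

end Duality

end Literature.NumberTheory.Automorphic.SymplecticCartan

end
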